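/-
Copyright (c) 2026 the pub-hodgecm-mathlib formalisation cell (harness21).  Prover seat hodgecm-mathlib-LH4-p05 (g0): Track A «(D-RAM) FOUR-FRAME» squad of crux H413
(dealer LH4-plan (g10) WORD #29 ∕ heir LEAD F0P3a-plan (g19) T18-07 (3): «(f) `stub_U2H_leviRow_wild` → p05», HOME census v2 §C∕§D, brick L7), 2026-09-03.
The hypothesis-form twin of ★ `UnitFundamentalLemmaInertLevi`'s Levi clause (F0P3b-p01 FILE F): the unramified hypothesis becomes the congruence binder `hJT` (★ L6 p855358),
proof VERBATIM; plus the quasi-split corollary (`H′ = Φ₃`, `T = 1`) at EVERY non-split place.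
-/
import Literature.NumberTheory.Rogawski1990.UnitFundamentalLemmaInertLevi                     -- ★ FILE F (shape of record): `isConj_of_isLocalStablyConjH_of_levi`, `isUnit_vecCons_sub_of_levi`, the inert clause; its import closure
import Literature.NumberTheory.Automorphic.UnitOrbitalIntegralSplitTorusNonsplitOfFormCongr    -- ★ L6 p855358 (this seat): the `G`-side split-torus value over the congruence binder `hJT`, and `T = 1` for `Φ₃`
import HarnessLib

/-!
# The unit fundamental lemma on the LEVI (split-torus) stratum, per `γ_H`, at ANY non-split place — the unramified hypothesis replaced by an integral congruence
# `H′_w ≅ Φ₃` (binder), and discharged for the quasi-split `U(2,1)` (`H′ = Φ₃`)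
(Rogawski 1990 §4.9 Prop. 4.9.1 (b), (4.9.2); §4.3 (4.3.1); Kottwitz 1986 §7)

Topic `NumberTheory/Rogawski1990`; namespace `Literature.NumberTheory.Rogawski1990` (as ★ FILE F).  THEOREMS ONLY (no definition, no instance, no notation, no named fact, no `sorry`).
Cell `pub/hodgecm-mathlib`, crux H413 = `stmt-HodgeConjecture-24833` (count-neutral), Track A «(D-RAM) FOUR-FRAME», unit U2H child (f) `stub_U2H_leviRow_wild` (LH4-p05 (g0)
census v2 8155187a2585211d §D: the Levi row of the anchor `1_{K₀}` is a coefficient test over the shared `coef`; this file is its `coef = ![1, 0]` skeleton — the transfer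
`1_{K_H} ↔ 1_{K₀}` on the Levi stratum — over the two explicit value binders `hΦH` (H-side module, ★ C′₂ place-generic) and `hΔ` (the transfer factor's value on integral
Levi matches; at a WILD place this is the line's Δ‴ dictionary, not the tame T5 chain)).

THE MATHEMATICS = ★ `UnitFundamentalLemmaInertLevi.stableOrbitalIntegralRel_indicator_eq_finsum_delta_of_levi_of_nonsplit` VERBATIM: its `hv` (unramified, good reduction)
enters only through the `G`-side value ★ `exists_classOrbitalIntegral_indicator_eq_twist_of_torus_regular_of_nonsplit`, whose `hv`-free twin over the congruence binder
`hJT : ∃ T ∈ GL₃(𝒪_w), H′_w = ᵗσ_w T·Φ₃·T` is ★ L6.  So: at ANY non-split place, for `γ_H = (diag(d′₀,d′₁), u) ∈ K_H` `(G,H)`-regular on the Levi stratum, ANY transfer factor `T`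
with `hΔ` and ANY `mH` with `hΦH`, **`Φ^st(γ_H, 1_{K_H}) = Σᶠ_c Δ(γ_H, out c)·Φ(c, 1_{K′})`** (`stableOrbitalIntegralRel_indicator_eq_finsum_delta_of_levi_of_formCongr`); and for
`H′ = Φ₃` with NO hypothesis on the place beyond non-splitness (`…_of_levi_antidiagOne`, `T = 1` by ★ `formCongr_one_eq` + ★ `placeForm_antidiagOne`).

HONEST LABEL: HC_CM is proved only modulo the 7 printed citations (2 remaining named inputs: hLiu418 = `stmt-HodgeConjecture-24832`, h413 = `stmt-HodgeConjecture-24833`) until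
rung 0 closes; this file is unconditional, asserts nothing printed and freezes no stub text.

## References
* [Rogawski1990] J. D. Rogawski, *Automorphic Representations of Unitary Groups in Three Variables*, Ann. of Math. Stud. 123 (1990): §4.9 Prop. 4.9.1 (b), (4.9.2)
  p. 55; §4.3 (4.3.1) p. 43; §3.5 Prop. 3.5.2 p. 29.
* [Kottwitz1986] R. E. Kottwitz, *Base change for unit elements of Hecke algebras*, Compositio Math. 60 (1986): §7.
-/

set_option autoImplicit false

noncomputable section

open MeasureTheory Measure Set NumberField IsDedekindDomain Matrix
open Literature.NumberTheory.Automorphic Literature.NumberTheory.Automorphic.UnitaryGroup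
open Literature.NumberTheory.GaloisRepresentations
open scoped NNReal Matrix MatrixGroups

namespace Literature.NumberTheory.Rogawski1990

/-! ## §1 Over the congruence binder -/

/-- **THE UNIT FUNDAMENTAL LEMMA ON THE LEVI STRATUM AT A NON-SPLIT PLACE, PER `γ_H`, OVER THE `H`-SIDE MODULE.**  At a finite place `v` of `L⁺` NON-SPLIT
(`c • w = w`), ANY ramification, with `H′_w` integrally congruent to `Φ₃` (binder `hJT`; `T = 1` for `H′ = Φ₃`), with a canonical family `mG` on `U(H′)(L⁺_v)` (`νG(K′) = 1`): let `γ_H = (g, u) ∈ K_H` with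
`g = diag(d′₀, d′₁)` (`glDiagonal 2 _ d′ = g`), `G`-regular, with `d′₀⁻¹u − 1`, `d′₀⁻¹d′₁ − 1`, `u − d′₁` units.  For ANY local transfer factor `T` taking the value
`‖d′₀⁻¹u − 1‖` at the integral matches of `γ_H` (`hΔ`; for Rogawski's `Δ‴_v` this is ★ `finExplicitDelta_eq_unitModulusChar_of_levi_of_nonsplit`) and ANY family `mH` on `H_v`
with `Φ(⟦γ_H⟧, 1_{K_H}) = (√‖d′₀⁻¹d′₁ − 1‖)⁻¹` (`hΦH`, the `H`-side of (4.9.2)): **`Φ^st(γ_H, 1_{K_H}) = ∑ᶠ c, Δ(γ_H, out c) · Φ(c, 1_{K′})`** — the body of ★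
`isLocalDeltaTransfer_iff` at `f^H = 1_{K_H}`, `f = 1_{K′}`.  Proof: ★ `stableOrbitalIntegralRel_indicator_eq_finsum_delta_iff_of_unique` with `huniqH` =
`isConj_of_isLocalStablyConjH_of_levi`, `huniqG` = ★ `isConj_of_isLocalNormPair_of_isLocalNormPair_of_levi`, the `G`-side value ★
`exists_classOrbitalIntegral_indicator_eq_twist_of_torus_regular_of_formCongr` (★ L6 p855358) `= (‖a − 1‖·√‖b − 1‖)⁻¹` (★ `twistModule_cmLocal_eq`) at the integral match `γ₀ ∈ K′`, and
`(√‖b − 1‖)⁻¹ = ‖a − 1‖ · (‖a − 1‖ · √‖b − 1‖)⁻¹`. [cite: Rogawski1990, §4.9 Prop. 4.9.1 (b), (4.9.2) p. 55; §4.3 (4.3.1) p. 43] [cite: Kottwitz1986, §7] -/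
theorem stableOrbitalIntegralRel_indicator_eq_finsum_delta_of_levi_of_formCongr
    (L : Type) [Field L] [NumberField L] [IsCMField L] (H' : Matrix (Fin 3) (Fin 3) L)
    (hH' : (H'.map (IsCMField.complexConj L))ᵀ = H') (hH'd : IsUnit H'.det)
    {v : HeightOneSpectrum (𝓞 ↥(maximalRealSubfield L))} (w : PlacesOver L v)
    (hw : IsCMField.complexConj L • w.1 = w.1)
    (hJT : ∃ T : GL (Fin 3) (w.1.adicCompletion L), T ∈ glInt 3 (w.1.adicCompletion L) ∧
      placeForm H' w.1 = formCongr (galAdicCompletionMap (L := L) (IsCMField.complexConj L) hw) T ((StdForm.antidiagonal 3).over (w.1.adicCompletion L)))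
    [MeasurableSpace ((cmDatum L 3 H').Local v)] [BorelSpace ((cmDatum L 3 H').Local v)]
    [∀ γ : ((cmDatum L 3 H').Local v), MeasurableSpace (((cmDatum L 3 H').Local v) ⧸ Subgroup.centralizer ({γ} : Set ((cmDatum L 3 H').Local v)))]
    [∀ γ : ((cmDatum L 3 H').Local v), BorelSpace (((cmDatum L 3 H').Local v) ⧸ Subgroup.centralizer ({γ} : Set ((cmDatum L 3 H').Local v)))]
    [∀ a : ((cmDatum L 2 (Matrix.of fun i j : Fin 2 => if i.val + j.val + 1 = 2 then (1 : L) else 0)).Local v ×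
      (cmDatum L 1 (Matrix.of fun i j : Fin 1 => if i.val + j.val + 1 = 1 then (1 : L) else 0)).Local v),
      MeasurableSpace (((cmDatum L 2 (Matrix.of fun i j : Fin 2 => if i.val + j.val + 1 = 2 then (1 : L) else 0)).Local v ×
      (cmDatum L 1 (Matrix.of fun i j : Fin 1 => if i.val + j.val + 1 = 1 then (1 : L) else 0)).Local v) ⧸ Subgroup.centralizer ({a} : Set ((cmDatum L 2 (Matrix.of fun i j : Fin 2 => if i.val + j.val + 1 = 2 then (1 : L) else 0)).Local v ×
      (cmDatum L 1 (Matrix.of fun i j : Fin 1 => if i.val + j.val + 1 = 1 then (1 : L) else 0)).Local v)))]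
    (νG : Measure ((cmDatum L 3 H').Local v)) [νG.IsHaarMeasure] [νG.IsMulRightInvariant]
    (T : LocalTransferFactor L H' v)
    (mH : OrbitalMeasureFamily ((cmDatum L 2 (Matrix.of fun i j : Fin 2 => if i.val + j.val + 1 = 2 then (1 : L) else 0)).Local v ×
      (cmDatum L 1 (Matrix.of fun i j : Fin 1 => if i.val + j.val + 1 = 1 then (1 : L) else 0)).Local v)) {mG : OrbitalMeasureFamily ((cmDatum L 3 H').Local v)}
    (hmG : mG.IsCanonical (fun γ => IsRegularElt (γ.val : GL (Fin 3) (UnitaryGroup.LocalRing L v))) νG)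
    (hνG : νG (cmLocalIntegralLevel L 3 H' v : Set ((cmDatum L 3 H').Local v)) = 1)
    {γH : ((cmDatum L 2 (Matrix.of fun i j : Fin 2 => if i.val + j.val + 1 = 2 then (1 : L) else 0)).Local v ×
      (cmDatum L 1 (Matrix.of fun i j : Fin 1 => if i.val + j.val + 1 = 1 then (1 : L) else 0)).Local v)}
    {d' : Fin 2 → (UnitaryGroup.LocalRing L v)ˣ} (hd' : glDiagonal 2 (UnitaryGroup.LocalRing L v) d' = (γH.1.val : GL (Fin 2) (UnitaryGroup.LocalRing L v)))
    (hγH : γH ∈ ((cmLocalIntegralLevel L 2 (Matrix.of fun i j : Fin 2 => if i.val + j.val + 1 = 2 then (1 : L) else 0) v).prod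
      (cmLocalIntegralLevel L 1 (Matrix.of fun i j : Fin 1 => if i.val + j.val + 1 = 1 then (1 : L) else 0) v)))
    (hreg : IsLocalGRegular L v γH)
    (ha : IsUnit ((((d' 0)⁻¹ * (isUnit_finGammaTwo L v γH).unit : (UnitaryGroup.LocalRing L v)ˣ) : UnitaryGroup.LocalRing L v) - 1))
    (hb : IsUnit ((((d' 0)⁻¹ * d' 1 : (UnitaryGroup.LocalRing L v)ˣ) : UnitaryGroup.LocalRing L v) - 1))
    (h12 : IsUnit (finGammaTwo L v γH - (d' 1 : UnitaryGroup.LocalRing L v)))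
    (hΦH : classOrbitalIntegral mH ((((cmLocalIntegralLevel L 2 (Matrix.of fun i j : Fin 2 => if i.val + j.val + 1 = 2 then (1 : L) else 0) v).prod
      (cmLocalIntegralLevel L 1 (Matrix.of fun i j : Fin 1 => if i.val + j.val + 1 = 1 then (1 : L) else 0) v)) : Set ((cmDatum L 2 (Matrix.of fun i j : Fin 2 => if i.val + j.val + 1 = 2 then (1 : L) else 0)).Local v ×
      (cmDatum L 1 (Matrix.of fun i j : Fin 1 => if i.val + j.val + 1 = 1 then (1 : L) else 0)).Local v)).indicator fun _ => (1 : ℂ)) (ConjClasses.mk γH) =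
      ((((NNReal.sqrt (unitModulusChar (UnitaryGroup.LocalRing L v) hb.unit))⁻¹ : ℝ≥0) : ℝ) : ℂ))
    (hΔ : ∀ γ₀ : (cmDatum L 3 H').Local v, γ₀ ∈ cmLocalIntegralLevel L 3 H' v → IsLocalNormPair L H' v γH γ₀ →
      T.Δ γH γ₀ = (((unitModulusChar (UnitaryGroup.LocalRing L v) ha.unit : ℝ≥0) : ℝ) : ℂ)) :
    stableOrbitalIntegralRel (IsLocalStablyConjH L v) mH ((((cmLocalIntegralLevel L 2 (Matrix.of fun i j : Fin 2 => if i.val + j.val + 1 = 2 then (1 : L) else 0) v).prod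
      (cmLocalIntegralLevel L 1 (Matrix.of fun i j : Fin 1 => if i.val + j.val + 1 = 1 then (1 : L) else 0) v)) : Set ((cmDatum L 2 (Matrix.of fun i j : Fin 2 => if i.val + j.val + 1 = 2 then (1 : L) else 0)).Local v ×
      (cmDatum L 1 (Matrix.of fun i j : Fin 1 => if i.val + j.val + 1 = 1 then (1 : L) else 0)).Local v)).indicator fun _ => (1 : ℂ)) γH =
      ∑ᶠ c : ConjClasses ((cmDatum L 3 H').Local v), T.Δ γH (Quotient.out c) *
        classOrbitalIntegral mG ((cmLocalIntegralLevel L 3 H' v : Set ((cmDatum L 3 H').Local v)).indicator fun _ => (1 : ℂ)) c := by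
  -- the torus datum `ι_v(γ_H) = diag(d′₀, u, d′₁) ∈ T(𝒪_v)`, regular
  have hι := endoEmbLocal_eq_glDiagonal_of_fst_eq L v γH hd'
  have ht := endoEmbLocal_mem_torusU_of_endoEmbLocal_eq L v γH hι
  have hint := endoEmbLocal_mem_cmLocalIntegralLevel_of_nonsplit L w hw hγH
  have hu : (((isUnit_finGammaTwo L v γH).unit : (UnitaryGroup.LocalRing L v)ˣ) : UnitaryGroup.LocalRing L v) = finGammaTwo L v γH :=
    (isUnit_finGammaTwo L v γH).unit_spec
  have hreg3 := isUnit_vecCons_sub_of_levi ha hb (by rw [hu]; exact h12)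
  -- the `G`-side value at the integral match `γ₀ = ψ⁻¹(t) ∈ K′`
  obtain ⟨γ₀, hγ₀K, hconj, hG⟩ := exists_classOrbitalIntegral_indicator_eq_twist_of_torus_regular_of_formCongr L H' hH' hH'd w hw hJT νG hmG hνG
    ⟨_, ht⟩ hι.symm hreg3 hreg ha hb hint
  have h₀ : IsLocalNormPair L H' v γH γ₀ := hconj
  rw [twistModule_cmLocal_eq L v ht hι.symm ha hb] at hG
  -- the frame of ★ `UnitFundamentalLemmaInertResiduallyRegular` §1
  have hHC := isLocalStablyConjH_of_isConj_and_conj L γH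
  have h01 : IsUnit ((d' 0 : UnitaryGroup.LocalRing L v) - d' 1) := by simpa using hreg3 0 2 (by decide)
  refine (stableOrbitalIntegralRel_indicator_eq_finsum_delta_iff_of_unique (IsLocalStablyConjH L v) T mH mG _ _ γH γ₀ hHC.1 hHC.2
    (fun k _ hst => isConj_of_isLocalStablyConjH_of_levi L hd' h01 hst)
    (fun k _ hk' => isConj_of_isLocalNormPair_of_isLocalNormPair_of_levi L H' hH' hH'd γH hι hreg3 h₀ hk')).2 ?_
  rw [hΦH, hΔ γ₀ hγ₀K h₀, hG, ← Complex.ofReal_mul]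
  congr 1
  have hne : ((unitModulusChar (UnitaryGroup.LocalRing L v) ha.unit : ℝ≥0) : ℝ) ≠ 0 :=
    NNReal.coe_ne_zero.2 ((Group.isUnit ha.unit).map (unitModulusChar (UnitaryGroup.LocalRing L v))).ne_zero
  rw [NNReal.coe_inv, NNReal.coe_inv, NNReal.coe_mul, mul_inv]
  exact (mul_inv_cancel_left₀ hne _).symm

open scoped Classical in

/-! ## §2 The quasi-split form `H′ = Φ₃` at every non-split place -/

/-- **THE LEVI CLAUSE FOR `U(Φ₃) = U(2,1)` AT ANY NON-SPLIT PLACE (tame or WILD)**: §1 at `H′ = Φ₃`, the congruence binder discharged by `T = 1` — the Levi∕split-torus row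
of the transfer `1_{K_H} ↔ 1_{K₀}` (`K₀ = U(Φ₃)(𝒪_v)`, the FOUR-FRAME anchor) over the two value binders `hΦH`, `hΔ`. [cite: Rogawski1990, §4.9 Prop. 4.9.1 (b), (4.9.2) p. 55; §4.3 (4.3.1) p. 43]
[cite: Kottwitz1986, §7] -/
theorem stableOrbitalIntegralRel_indicator_eq_finsum_delta_of_levi_antidiagOne
    (L : Type) [Field L] [NumberField L] [IsCMField L]
    {v : HeightOneSpectrum (𝓞 ↥(maximalRealSubfield L))} (w : PlacesOver L v)
    (hw : IsCMField.complexConj L • w.1 = w.1)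
    [MeasurableSpace ((cmDatum L 3 (Matrix.of fun i j : Fin 3 => if i.val + j.val + 1 = 3 then (1 : L) else 0)).Local v)] [BorelSpace ((cmDatum L 3 (Matrix.of fun i j : Fin 3 => if i.val + j.val + 1 = 3 then (1 : L) else 0)).Local v)]
    [∀ γ : ((cmDatum L 3 (Matrix.of fun i j : Fin 3 => if i.val + j.val + 1 = 3 then (1 : L) else 0)).Local v), MeasurableSpace (((cmDatum L 3 (Matrix.of fun i j : Fin 3 => if i.val + j.val + 1 = 3 then (1 : L) else 0)).Local v) ⧸ Subgroup.centralizer ({γ} : Set ((cmDatum L 3 (Matrix.of fun i j : Fin 3 => if i.val + j.val + 1 = 3 then (1 : L) else 0)).Local v)))]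
    [∀ γ : ((cmDatum L 3 (Matrix.of fun i j : Fin 3 => if i.val + j.val + 1 = 3 then (1 : L) else 0)).Local v), BorelSpace (((cmDatum L 3 (Matrix.of fun i j : Fin 3 => if i.val + j.val + 1 = 3 then (1 : L) else 0)).Local v) ⧸ Subgroup.centralizer ({γ} : Set ((cmDatum L 3 (Matrix.of fun i j : Fin 3 => if i.val + j.val + 1 = 3 then (1 : L) else 0)).Local v)))]
    [∀ a : ((cmDatum L 2 (Matrix.of fun i j : Fin 2 => if i.val + j.val + 1 = 2 then (1 : L) else 0)).Local v ×
      (cmDatum L 1 (Matrix.of fun i j : Fin 1 => if i.val + j.val + 1 = 1 then (1 : L) else 0)).Local v),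
      MeasurableSpace (((cmDatum L 2 (Matrix.of fun i j : Fin 2 => if i.val + j.val + 1 = 2 then (1 : L) else 0)).Local v ×
      (cmDatum L 1 (Matrix.of fun i j : Fin 1 => if i.val + j.val + 1 = 1 then (1 : L) else 0)).Local v) ⧸ Subgroup.centralizer ({a} : Set ((cmDatum L 2 (Matrix.of fun i j : Fin 2 => if i.val + j.val + 1 = 2 then (1 : L) else 0)).Local v ×
      (cmDatum L 1 (Matrix.of fun i j : Fin 1 => if i.val + j.val + 1 = 1 then (1 : L) else 0)).Local v)))]
    (νG : Measure ((cmDatum L 3 (Matrix.of fun i j : Fin 3 => if i.val + j.val + 1 = 3 then (1 : L) else 0)).Local v)) [νG.IsHaarMeasure] [νG.IsMulRightInvariant]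
    (T : LocalTransferFactor L (Matrix.of fun i j : Fin 3 => if i.val + j.val + 1 = 3 then (1 : L) else 0) v)
    (mH : OrbitalMeasureFamily ((cmDatum L 2 (Matrix.of fun i j : Fin 2 => if i.val + j.val + 1 = 2 then (1 : L) else 0)).Local v ×
      (cmDatum L 1 (Matrix.of fun i j : Fin 1 => if i.val + j.val + 1 = 1 then (1 : L) else 0)).Local v)) {mG : OrbitalMeasureFamily ((cmDatum L 3 (Matrix.of fun i j : Fin 3 => if i.val + j.val + 1 = 3 then (1 : L) else 0)).Local v)}
    (hmG : mG.IsCanonical (fun γ => IsRegularElt (γ.val : GL (Fin 3) (UnitaryGroup.LocalRing L v))) νG)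
    (hνG : νG (cmLocalIntegralLevel L 3 (Matrix.of fun i j : Fin 3 => if i.val + j.val + 1 = 3 then (1 : L) else 0) v : Set ((cmDatum L 3 (Matrix.of fun i j : Fin 3 => if i.val + j.val + 1 = 3 then (1 : L) else 0)).Local v)) = 1)
    {γH : ((cmDatum L 2 (Matrix.of fun i j : Fin 2 => if i.val + j.val + 1 = 2 then (1 : L) else 0)).Local v ×
      (cmDatum L 1 (Matrix.of fun i j : Fin 1 => if i.val + j.val + 1 = 1 then (1 : L) else 0)).Local v)}
    {d' : Fin 2 → (UnitaryGroup.LocalRing L v)ˣ} (hd' : glDiagonal 2 (UnitaryGroup.LocalRing L v) d' = (γH.1.val : GL (Fin 2) (UnitaryGroup.LocalRing L v)))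
    (hγH : γH ∈ ((cmLocalIntegralLevel L 2 (Matrix.of fun i j : Fin 2 => if i.val + j.val + 1 = 2 then (1 : L) else 0) v).prod
      (cmLocalIntegralLevel L 1 (Matrix.of fun i j : Fin 1 => if i.val + j.val + 1 = 1 then (1 : L) else 0) v)))
    (hreg : IsLocalGRegular L v γH)
    (ha : IsUnit ((((d' 0)⁻¹ * (isUnit_finGammaTwo L v γH).unit : (UnitaryGroup.LocalRing L v)ˣ) : UnitaryGroup.LocalRing L v) - 1))
    (hb : IsUnit ((((d' 0)⁻¹ * d' 1 : (UnitaryGroup.LocalRing L v)ˣ) : UnitaryGroup.LocalRing L v) - 1))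
    (h12 : IsUnit (finGammaTwo L v γH - (d' 1 : UnitaryGroup.LocalRing L v)))
    (hΦH : classOrbitalIntegral mH ((((cmLocalIntegralLevel L 2 (Matrix.of fun i j : Fin 2 => if i.val + j.val + 1 = 2 then (1 : L) else 0) v).prod
      (cmLocalIntegralLevel L 1 (Matrix.of fun i j : Fin 1 => if i.val + j.val + 1 = 1 then (1 : L) else 0) v)) : Set ((cmDatum L 2 (Matrix.of fun i j : Fin 2 => if i.val + j.val + 1 = 2 then (1 : L) else 0)).Local v ×
      (cmDatum L 1 (Matrix.of fun i j : Fin 1 => if i.val + j.val + 1 = 1 then (1 : L) else 0)).Local v)).indicator fun _ => (1 : ℂ)) (ConjClasses.mk γH) =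
      ((((NNReal.sqrt (unitModulusChar (UnitaryGroup.LocalRing L v) hb.unit))⁻¹ : ℝ≥0) : ℝ) : ℂ))
    (hΔ : ∀ γ₀ : (cmDatum L 3 (Matrix.of fun i j : Fin 3 => if i.val + j.val + 1 = 3 then (1 : L) else 0)).Local v, γ₀ ∈ cmLocalIntegralLevel L 3 (Matrix.of fun i j : Fin 3 => if i.val + j.val + 1 = 3 then (1 : L) else 0) v → IsLocalNormPair L (Matrix.of fun i j : Fin 3 => if i.val + j.val + 1 = 3 then (1 : L) else 0) v γH γ₀ →
      T.Δ γH γ₀ = (((unitModulusChar (UnitaryGroup.LocalRing L v) ha.unit : ℝ≥0) : ℝ) : ℂ)) :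
    stableOrbitalIntegralRel (IsLocalStablyConjH L v) mH ((((cmLocalIntegralLevel L 2 (Matrix.of fun i j : Fin 2 => if i.val + j.val + 1 = 2 then (1 : L) else 0) v).prod
      (cmLocalIntegralLevel L 1 (Matrix.of fun i j : Fin 1 => if i.val + j.val + 1 = 1 then (1 : L) else 0) v)) : Set ((cmDatum L 2 (Matrix.of fun i j : Fin 2 => if i.val + j.val + 1 = 2 then (1 : L) else 0)).Local v ×
      (cmDatum L 1 (Matrix.of fun i j : Fin 1 => if i.val + j.val + 1 = 1 then (1 : L) else 0)).Local v)).indicator fun _ => (1 : ℂ)) γH =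
      ∑ᶠ c : ConjClasses ((cmDatum L 3 (Matrix.of fun i j : Fin 3 => if i.val + j.val + 1 = 3 then (1 : L) else 0)).Local v), T.Δ γH (Quotient.out c) *
        classOrbitalIntegral mG ((cmLocalIntegralLevel L 3 (Matrix.of fun i j : Fin 3 => if i.val + j.val + 1 = 3 then (1 : L) else 0) v : Set ((cmDatum L 3 (Matrix.of fun i j : Fin 3 => if i.val + j.val + 1 = 3 then (1 : L) else 0)).Local v)).indicator fun _ => (1 : ℂ)) c :=
  stableOrbitalIntegralRel_indicator_eq_finsum_delta_of_levi_of_formCongr L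
    (Matrix.of fun i j : Fin 3 => if i.val + j.val + 1 = 3 then (1 : L) else 0)
    (antidiagOne_map_transpose (IsCMField.complexConj L) 3) (isUnit_antidiagOne_det L 3) w hw
    ⟨1, one_mem _, by rw [formCongr_one_eq, placeForm_antidiagOne]⟩ νG T mH hmG hνG hd' hγH hreg ha hb h12 hΦH hΔ

end Literature.NumberTheory.Rogawski1990

end
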